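import Literature.Probability.Percolation.NoThreeBranches
import HarnessLib

/-!
# Bridges with two infinite sides ("`U`-edges") and the deterministic geometry of Raoufi's Lemma 3

Topic `Literature/Probability/Percolation`; theorems and plain definitions only (no named facts).
This file contains the graph theory behind §3 of

* A. Raoufi, *Translation-invariant Gibbs states of the Ising model: general setting*, Ann. Probab.
  48 (2020) 760–777 (arXiv:1710.07608), the event `A_{xy}` and the set `U(n)` (p. 7 and p. 9),
  Lemma 3 with its Claim 1 (pp. 9–11), and the structure used in the proof of Lemma 4 (p. 12),

for an arbitrary bond configuration `ω : BondConfig V` (`= Set (Sym2 V)`, the trace of the current)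
together with a set `D ⊆ Sym2 V` of "doubled" bonds (the bonds carrying current `≥ 2`; Raoufi's
conditions `n_{xy} = 1` read `s(x,y) ∈ ω ∖ D`). Everything here is deterministic; the probabilistic
part of Lemma 3 is elsewhere.

* `IsBridge ω a b` — `s(a,b)` is open and `a`, `b` are disconnected once it is removed;
  `side ω a b` — the open cluster of `a` in `ω ∖ {s(a,b)}` (the "`a`-side");
  `IsUPair ω D a b` — **Raoufi's event `A_{ab}`** (p. 7): `n_{ab} = 1` (`s(a,b) ∈ ω ∖ D`), both `a` and
  `b` are joined to infinity in `n` with the bond removed, and not to each other;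
  `uEdges ω D` — **the set `U(n)`** (p. 9); `IsSpecial ω D a b` — a `U`-pair whose `a`-side contains no
  endpoint of another `U`-edge (our replacement for the "two edge-disjoint infinite paths" of the
  proof of Claim 1, see below).
* Sides of a bridge partition the cluster (`IsBridge.mem_side_or`, `IsBridge.disjoint_sides`), other
  bonds do not cross (`mem_side_iff_of_ne`).
* **Two `U`-edges** `e = s(a,b)`, `e' = s(a',b')` with `e'` on the `a`-side of `e` and `e` on the
  `b'`-side of `e'`: removing both splits the cluster into the `b`-side of `e`, the `a'`-side of `e'`
  and a middle piece `C_a(ω ∖ {e,e'}) ∋ a, b'` (`openCluster_sdiff_pair_eq_side`,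
  `openCluster_sdiff_pair_eq_side'`, `reachable_sdiff_pair`, `mem_or_mem_of_mem_side`); if the middle
  piece is infinite there are three infinite branches (`mem_threeBranches_of_infinite_middle`). This is
  the structure invoked on p. 12 ("the definition of `U(n)` and the uniqueness of the infinite cluster
  guarantee that `n' ∈ B_m(x,x',y,y')`"), made precise.
* **Lemma 3 (i), deterministic core** (`reachable_sdiff_uEdges_of_oneDisjoint`, p. 10: "if
  `f(x,y,n) ≥ 2` then `x` is connected to `y` in `n'`", `n'` = `n` with the `U`-edges closed): two open
  walks from `x` to `y` such that every bond used by both is doubled avoid all `U`-edges.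
* **Lemma 3 (ii), deterministic core** (`mem_threeBranches_of_three_oneDisjoint_walks`, p. 11): three
  pairwise "1-disjoint" open walks from `x` leaving a set containing the `U`-closed cluster of `x` force
  three infinite branches.
* **Claim 1, deterministic core** (`exists_isSpecial`, pp. 10–11): if the `U`-closed configuration has
  an infinite cluster (in the cluster of a `U`-edge) and there are no three infinite branches, a special
  `U`-edge exists (induction along an open walk, using the two-`U`-edges structure; this replaces the
  appeal to Menger's theorem in the printed proof); and **three special `U`-edges force three infinite
  branches** (`mem_threeBranches_of_three_isSpecial`, the last paragraph of the proof of Claim 1).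

## References

* A. Raoufi, Ann. Probab. 48 (2020) 760–777, §3, pp. 7–12 [Raoufi2020].

## Mathlib status

Anchors: `SimpleGraph.Walk` (`takeUntil`, `length_takeUntil_lt_length`, `transfer`, `bypass`,
`isTrail_cons`, `fst_mem_support_of_mem_edges`), `SimpleGraph.fromEdgeSet`; tree: `openGraph`,
`openCluster`, `percolatesAt` (`Percolation.lean`), `threeBranches`,
`exists_branch_of_percolatesAt` (`NoThreeBranches.lean`, `UniquenessInfiniteCluster.lean`).
-/

noncomputable section

namespace Literature.Probability.Percolation

open SimpleGraph

variable {V : Type*}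

/-! ### Walks and sub-configurations -/

section Walks

/-- Open paths survive enlarging the configuration. [folklore] -/
private theorem reachable_of_config_subset {ω ω' : BondConfig V} (h : ω ⊆ ω') {u v : V}
    (huv : (openGraph ω).Reachable u v) : (openGraph ω').Reachable u v :=
  huv.mono (fromEdgeSet_mono h)

/-- The bonds of an open walk are open. [folklore] -/
private theorem mem_of_mem_edges {ω : BondConfig V} {u v : V} (p : (openGraph ω).Walk u v) {e : Sym2 V}
    (he : e ∈ p.edges) : e ∈ ω := by
  have h := p.edges_subset_edgeSet he
  rw [openGraph, edgeSet_fromEdgeSet] at h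
  exact h.1

/-- The bonds of an open walk are not loops. [folklore] -/
theorem not_isDiag_of_mem_edges {ω : BondConfig V} {u v : V} (p : (openGraph ω).Walk u v) {e : Sym2 V}
    (he : e ∈ p.edges) : ¬e.IsDiag := by
  have h := p.edges_subset_edgeSet he
  rw [openGraph, edgeSet_fromEdgeSet] at h
  exact h.2

/-- **Transfer of an open walk** to a configuration containing all its bonds (same length). [folklore] -/
def transferWalk {ω : BondConfig V} (ω' : BondConfig V) {u v : V} (p : (openGraph ω).Walk u v)
    (h : ∀ e ∈ p.edges, e ∈ ω') : (openGraph ω').Walk u v :=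
  p.transfer (openGraph ω') fun e he => by
    rw [openGraph, edgeSet_fromEdgeSet]
    exact ⟨h e he, not_isDiag_of_mem_edges p he⟩

/-- The transferred walk has the same length. [folklore] -/
@[simp] theorem length_transferWalk {ω : BondConfig V} (ω' : BondConfig V) {u v : V}
    (p : (openGraph ω).Walk u v) (h : ∀ e ∈ p.edges, e ∈ ω') :
    (transferWalk ω' p h).length = p.length := by
  simp [transferWalk, Walk.length_transfer]

/-- The transferred walk has the same bonds. [folklore] -/
@[simp] theorem edges_transferWalk {ω : BondConfig V} (ω' : BondConfig V) {u v : V}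
    (p : (openGraph ω).Walk u v) (h : ∀ e ∈ p.edges, e ∈ ω') :
    (transferWalk ω' p h).edges = p.edges := by
  simp [transferWalk, Walk.edges_transfer]

/-- An open walk all of whose bonds lie in `ω'` joins its endpoints in `ω'`. [folklore] -/
private theorem reachable_of_walk_edges_subset {ω ω' : BondConfig V} {u v : V} (p : (openGraph ω).Walk u v)
    (h : ∀ e ∈ p.edges, e ∈ ω') : (openGraph ω').Reachable u v :=
  ⟨transferWalk ω' p h⟩

/-- An open walk avoiding the bonds of `S` is an open walk of `ω ∖ S`. [folklore] -/
theorem reachable_sdiff_of_walk_avoiding {ω : BondConfig V} (S : Set (Sym2 V)) {u v : V}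
    (p : (openGraph ω).Walk u v) (h : ∀ e ∈ p.edges, e ∉ S) : (openGraph (ω \ S)).Reachable u v :=
  reachable_of_walk_edges_subset p fun e he => ⟨mem_of_mem_edges p he, h e he⟩

/-- **First bond in `S` along a walk.** If an open walk from `u` uses a bond of `S`, let `s(a,b)` be the
first one, traversed from `a` to `b`: then `u` is joined to `a` in `ω ∖ S`. [folklore] -/
theorem exists_first_mem_edges {ω : BondConfig V} (S : Set (Sym2 V)) {u v : V}
    (p : (openGraph ω).Walk u v) (hS : ∃ e ∈ p.edges, e ∈ S) :
    ∃ a b, s(a, b) ∈ S ∧ s(a, b) ∈ p.edges ∧ s(a, b) ∈ ω ∧ a ≠ b ∧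
      (openGraph (ω \ S)).Reachable u a := by
  induction p with
  | nil => obtain ⟨e, he, -⟩ := hS; simp at he
  | @cons x y z hadj q ih =>
    have hadj' := hadj
    rw [openGraph_adj] at hadj'
    by_cases hxy : s(x, y) ∈ S
    · exact ⟨x, y, hxy, by simp [Walk.edges_cons], hadj'.1, hadj'.2, Reachable.refl _⟩
    · obtain ⟨e, he, heS⟩ := hS
      rw [Walk.edges_cons, List.mem_cons] at he
      rcases he with rfl | he
      · exact absurd heS hxy
      obtain ⟨a, b, hab, habq, hω, hne, hya⟩ := ih ⟨e, he, heS⟩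
      have hstep : (openGraph (ω \ S)).Adj x y := by
        rw [openGraph_adj]; exact ⟨⟨hadj'.1, hxy⟩, hadj'.2⟩
      exact ⟨a, b, hab, by rw [Walk.edges_cons]; exact List.mem_cons_of_mem _ habq, hω, hne,
        hstep.reachable.trans hya⟩

/-- Either an open walk avoids `S` (so its endpoints are joined in `ω ∖ S`), or its start is joined in
`ω ∖ S` to an endpoint of a bond of `S` that the walk uses. [folklore] -/
theorem reachable_sdiff_or_exists_first {ω : BondConfig V} (S : Set (Sym2 V)) {u v : V}
    (p : (openGraph ω).Walk u v) :
    (openGraph (ω \ S)).Reachable u v ∨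
      ∃ a b, s(a, b) ∈ S ∧ s(a, b) ∈ p.edges ∧ s(a, b) ∈ ω ∧ a ≠ b ∧ (openGraph (ω \ S)).Reachable u a := by
  by_cases h : ∃ e ∈ p.edges, e ∈ S
  · exact Or.inr (exists_first_mem_edges S p h)
  · push Not at h
    exact Or.inl (reachable_sdiff_of_walk_avoiding S p h)

/-- **A trail through the bond `s(a,b)`**: the part before the bond joins the start to one endpoint and
the part after it joins the other endpoint to the end, both avoiding the bond (a trail uses it once). [folklore] -/
theorem reachable_sdiff_of_isTrail_of_mem_edges {ω : BondConfig V} {u v a b : V}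
    {p : (openGraph ω).Walk u v} (hp : p.IsTrail) (he : s(a, b) ∈ p.edges) :
    ((openGraph (ω \ {s(a, b)})).Reachable u a ∧ (openGraph (ω \ {s(a, b)})).Reachable b v) ∨
    ((openGraph (ω \ {s(a, b)})).Reachable u b ∧ (openGraph (ω \ {s(a, b)})).Reachable a v) := by
  induction p with
  | nil => simp at he
  | @cons x y z hadj q ih =>
    rw [Walk.isTrail_cons] at hp
    rw [Walk.edges_cons, List.mem_cons] at he
    by_cases hfirst : s(a, b) = s(x, y)
    · -- the first bond is `s(a,b)`; the rest of the trail avoids it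
      have hq : (openGraph (ω \ {s(a, b)})).Reachable y z :=
        reachable_sdiff_of_walk_avoiding {s(a, b)} q fun e he' heq => by
          rw [Set.mem_singleton_iff] at heq
          rw [heq, hfirst] at he'
          exact hp.2 he'
      rcases Sym2.eq_iff.1 hfirst with ⟨rfl, rfl⟩ | ⟨rfl, rfl⟩
      · exact Or.inl ⟨Reachable.refl _, hq⟩
      · exact Or.inr ⟨Reachable.refl _, hq⟩
    · rcases he with he | he
      · exact absurd he hfirst
      have hstep : (openGraph (ω \ {s(a, b)})).Adj x y := by
        rw [openGraph_adj] at hadj ⊢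
        refine ⟨⟨hadj.1, ?_⟩, hadj.2⟩
        rw [Set.mem_singleton_iff]
        exact fun h => hfirst h.symm
      rcases ih hp.1 he with ⟨h1, h2⟩ | ⟨h1, h2⟩
      · exact Or.inl ⟨hstep.reachable.trans h1, h2⟩
      · exact Or.inr ⟨hstep.reachable.trans h1, h2⟩

/-- **Shortest initial segment reaching a set of vertices**: a walk ending in `T` has an initial segment
(no longer, using only bonds of the walk) which meets `T` exactly at its endpoint. [folklore] -/
theorem exists_walk_meets_only_at_end {G : SimpleGraph V} {u v : V} (p : G.Walk u v) (T : Set V)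
    (hv : v ∈ T) :
    ∃ w, w ∈ T ∧ ∃ q : G.Walk u w, q.length ≤ p.length ∧ (∀ e ∈ q.edges, e ∈ p.edges) ∧
      ∀ z ∈ q.support, z ∈ T → z = w := by
  induction p with
  | nil => exact ⟨_, hv, Walk.nil, le_rfl, fun e he => he, fun z hz _ => by simpa using hz⟩
  | @cons x y z hadj q ih =>
    by_cases hx : x ∈ T
    · exact ⟨x, hx, Walk.nil, Nat.zero_le _, fun e he => by simp at he, fun w hw _ => by simpa using hw⟩
    · obtain ⟨w, hw, q', hlen, hedges, honly⟩ := ih hv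
      refine ⟨w, hw, Walk.cons hadj q', ?_, fun e he => ?_, fun t ht htT => ?_⟩
      · rw [Walk.length_cons, Walk.length_cons]; omega
      · rw [Walk.edges_cons, List.mem_cons] at he ⊢
        rcases he with h | h
        · exact Or.inl h
        · exact Or.inr (hedges e h)
      · rw [Walk.support_cons, List.mem_cons] at ht
        rcases ht with rfl | ht
        · exact absurd htT hx
        · exact honly t ht htT

/-- **Walks inside a cluster avoid the bonds that do not touch it**: if every bond of `T` which is open
in `ω₀` has no endpoint in the cluster of `c`, then the cluster of `c` in `ω₀ ∖ T` is the cluster of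
`c` in `ω₀`. [folklore] -/
theorem reachable_sdiff_of_mem_openCluster {ω₀ : BondConfig V} {T : Set (Sym2 V)} {c : V}
    (hT : ∀ e ∈ T, e ∈ ω₀ → ∀ y ∈ e, y ∉ openCluster ω₀ c) {x v : V}
    (p : (openGraph ω₀).Walk x v) (hx : x ∈ openCluster ω₀ c) : (openGraph (ω₀ \ T)).Reachable x v := by
  induction p with
  | nil => exact Reachable.refl _
  | @cons x y z hadj q ih =>
    have hadj' := hadj
    rw [openGraph_adj] at hadj'
    have hxy : s(x, y) ∉ T := fun h => hT _ h hadj'.1 x (Sym2.mem_mk_left x y) hx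
    have hy : y ∈ openCluster ω₀ c := (show (openGraph ω₀).Reachable c x from hx).trans hadj.reachable
    have hstep : (openGraph (ω₀ \ T)).Adj x y := by
      rw [openGraph_adj]; exact ⟨⟨hadj'.1, hxy⟩, hadj'.2⟩
    exact hstep.reachable.trans (ih hy)

/-- Set form of the previous lemma: the cluster does not shrink when the bonds of `T` are closed. [folklore] -/
theorem openCluster_subset_openCluster_sdiff {ω₀ : BondConfig V} {T : Set (Sym2 V)} {c : V}
    (hT : ∀ e ∈ T, e ∈ ω₀ → ∀ y ∈ e, y ∉ openCluster ω₀ c) :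
    openCluster ω₀ c ⊆ openCluster (ω₀ \ T) c := by
  intro v hv
  obtain ⟨p⟩ := (show (openGraph ω₀).Reachable c v from hv)
  exact reachable_sdiff_of_mem_openCluster hT p (mem_openCluster_self ω₀ c)

end Walks

/-! ### Bridges and their sides -/

section Bridge

/-- `s(a,b)` is a **bridge** of the configuration `ω`: it is open, and `a`, `b` are not joined by an open
path once it is removed (Raoufi 2020, p. 7, the last condition "`x ↮ y` in `n_{[xy]}`" of the event
`A_{xy}`). [cite: Raoufi2020, §3, p. 7 (the event A_xy)] -/
def IsBridge (ω : BondConfig V) (a b : V) : Prop :=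
  s(a, b) ∈ ω ∧ a ≠ b ∧ ¬(openGraph (ω \ {s(a, b)})).Reachable a b

/-- The **`a`-side** of the bond `s(a,b)`: the open cluster of `a` after removing the bond (for a bridge,
one of the two pieces; Raoufi 2020, p. 7, "`x ↔ ∞` in `n_{[xy]}`"). [cite: Raoufi2020, §3, p. 7 (the event A_xy)] -/
def side (ω : BondConfig V) (a b : V) : Set V := openCluster (ω \ {s(a, b)}) a

variable {ω : BondConfig V} {a b : V}

/-- Membership in a side, unfolded. [folklore] -/
theorem mem_side_iff {v : V} : v ∈ side ω a b ↔ (openGraph (ω \ {s(a, b)})).Reachable a v := Iff.rfl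

/-- The `b`-side is the cluster of `b` after removing the same bond. [folklore] -/
theorem side_swap_eq : side ω b a = openCluster (ω \ {s(a, b)}) b := by
  rw [side, Sym2.eq_swap]

/-- Membership in the other side, unfolded. [folklore] -/
theorem mem_side_swap_iff {v : V} : v ∈ side ω b a ↔ (openGraph (ω \ {s(a, b)})).Reachable b v := by
  rw [side_swap_eq]; rfl

/-- `a` lies on its own side. [folklore] -/
@[simp] theorem self_mem_side : a ∈ side ω a b := mem_openCluster_self _ a

/-- Bridges are symmetric. [folklore] -/
theorem IsBridge.symm (h : IsBridge ω a b) : IsBridge ω b a := by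
  refine ⟨by rw [Sym2.eq_swap]; exact h.1, h.2.1.symm, fun hr => h.2.2 ?_⟩
  rw [Sym2.eq_swap] at hr
  exact hr.symm

/-- Sides are closed under open paths avoiding the bond. [folklore] -/
theorem mem_side_of_reachable {v w : V} (hv : v ∈ side ω a b)
    (hvw : (openGraph (ω \ {s(a, b)})).Reachable v w) : w ∈ side ω a b :=
  (show (openGraph (ω \ {s(a, b)})).Reachable a v from hv).trans hvw

/-- The cluster (without the bond) of a vertex of a side is the side. [folklore] -/
theorem openCluster_eq_side_of_mem {v : V} (hv : v ∈ side ω a b) :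
    openCluster (ω \ {s(a, b)}) v = side ω a b := by
  ext w
  exact ⟨fun hw => mem_side_of_reachable hv hw,
    fun hw => (show (openGraph (ω \ {s(a, b)})).Reachable a v from hv).symm.trans hw⟩

/-- **The two sides of a bridge are disjoint.** [folklore] -/
theorem IsBridge.disjoint_sides (h : IsBridge ω a b) {v : V} (ha : v ∈ side ω a b)
    (hb : v ∈ side ω b a) : False := by
  rw [mem_side_swap_iff] at hb
  exact h.2.2 ((show (openGraph (ω \ {s(a, b)})).Reachable a v from ha).trans hb.symm)

/-- For a bridge, `b` is not on the `a`-side. [folklore] -/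
theorem IsBridge.notMem_side (h : IsBridge ω a b) : b ∉ side ω a b := fun hb => h.2.2 hb

/-- **Other open bonds do not cross**: an open bond different from `s(a,b)` with one endpoint on the
`a`-side has both endpoints there. [folklore] -/
theorem mem_side_of_adj {v w : V} (hv : v ∈ side ω a b) (hvw : s(v, w) ∈ ω) (hne : v ≠ w)
    (he : s(v, w) ≠ s(a, b)) : w ∈ side ω a b := by
  refine mem_side_of_reachable hv (Adj.reachable ?_)
  rw [openGraph_adj]
  exact ⟨⟨hvw, by rwa [Set.mem_singleton_iff]⟩, hne⟩

/-- For an open bond `s(a',b') ≠ s(a,b)`: `a'` is on the `a`-side iff `b'` is. [folklore] -/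
theorem mem_side_iff_of_ne {a' b' : V} (hω : s(a', b') ∈ ω) (hne' : a' ≠ b') (hne : s(a', b') ≠ s(a, b)) :
    a' ∈ side ω a b ↔ b' ∈ side ω a b :=
  ⟨fun h => mem_side_of_adj h hω hne' hne,
    fun h => mem_side_of_adj h (by rw [Sym2.eq_swap]; exact hω) hne'.symm (by rw [Sym2.eq_swap]; exact hne)⟩

/-- **The sides of a bridge cover the cluster**: every vertex joined to `a` by an open path lies on the
`a`-side or on the `b`-side. [folklore] -/
theorem IsBridge.mem_side_or (h : IsBridge ω a b) {v : V} (hv : (openGraph ω).Reachable a v) :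
    v ∈ side ω a b ∨ v ∈ side ω b a := by
  obtain ⟨p⟩ := hv.symm
  rcases reachable_sdiff_or_exists_first {s(a, b)} p with hva | ⟨x, y, hxy, -, -, -, hvx⟩
  · exact Or.inl hva.symm
  · rw [Set.mem_singleton_iff] at hxy
    rcases Sym2.eq_iff.1 hxy with ⟨rfl, rfl⟩ | ⟨rfl, rfl⟩
    · exact Or.inl hvx.symm
    · right
      rw [mem_side_swap_iff]
      exact hvx.symm

end Bridge

/-! ### `U`-edges (the event `A_{xy}`) and special `U`-edges -/

section UEdges

/-- **Raoufi's event `A_{ab}`** for the pair `(ω, D)` = (trace of the current, bonds with current `≥ 2`):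
`n_{ab} = 1` (`s(a,b)` open and not doubled), `a ↔ ∞` and `b ↔ ∞` in the configuration with the bond
removed, and `a ↮ b` there (Raoufi 2020, p. 7 and Fig. 1). [cite: Raoufi2020, §3, p. 7 (the event A_xy)] -/
def IsUPair (ω : BondConfig V) (D : Set (Sym2 V)) (a b : V) : Prop :=
  IsBridge ω a b ∧ s(a, b) ∉ D ∧ (ω \ {s(a, b)}) ∈ percolatesAt a ∧ (ω \ {s(a, b)}) ∈ percolatesAt b

/-- **The set `U(n) = {{x,y} : n ∈ A_{xy}}`** (Raoufi 2020, p. 9). [cite: Raoufi2020, §3, p. 9 (the set U(n))] -/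
def uEdges (ω : BondConfig V) (D : Set (Sym2 V)) : Set (Sym2 V) :=
  {e | ∃ a b, e = s(a, b) ∧ IsUPair ω D a b}

/-- A **special `U`-pair**: a `U`-pair `(a,b)` such that no other `U`-edge has an endpoint on the
`a`-side. (In the proof of Raoufi 2020, Lemma 3, Claim 1, pp. 10–11, the role of the special edges is
played by the `U`-edges `{u₀,u₁}` carrying "two edge-disjoint one-sided infinite paths starting from `u₁`
which do not cross the edge `{u₀,u₁}`"; the present combinatorial substitute avoids Menger's theorem.) [cite: Raoufi2020, Lemma 3, Claim 1 (pp. 10–11)] -/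
def IsSpecial (ω : BondConfig V) (D : Set (Sym2 V)) (a b : V) : Prop :=
  IsUPair ω D a b ∧ ∀ a' b', IsUPair ω D a' b' → s(a', b') ≠ s(a, b) → a' ∉ side ω a b

variable {ω : BondConfig V} {D : Set (Sym2 V)} {a b : V}

/-- `U`-pairs are symmetric. [folklore] -/
theorem IsUPair.symm (h : IsUPair ω D a b) : IsUPair ω D b a := by
  obtain ⟨hbr, hD, ha, hb⟩ := h
  refine ⟨hbr.symm, by rwa [Sym2.eq_swap], ?_, ?_⟩
  · rw [Sym2.eq_swap]; exact hb
  · rw [Sym2.eq_swap]; exact ha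

/-- The bond of a `U`-pair is a `U`-edge. [folklore] -/
theorem IsUPair.mem_uEdges (h : IsUPair ω D a b) : s(a, b) ∈ uEdges ω D := ⟨a, b, rfl, h⟩

/-- A `U`-edge read at either orientation is a `U`-pair. [folklore] -/
theorem isUPair_of_mem_uEdges (h : s(a, b) ∈ uEdges ω D) : IsUPair ω D a b := by
  obtain ⟨a', b', hab, h'⟩ := h
  rcases Sym2.eq_iff.1 hab with ⟨rfl, rfl⟩ | ⟨rfl, rfl⟩
  · exact h'
  · exact h'.symm

/-- `U`-edges are open. [folklore] -/
theorem uEdges_subset : uEdges ω D ⊆ ω := by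
  rintro e ⟨a, b, rfl, h⟩
  exact h.1.1

/-- `U`-edges are not doubled. [folklore] -/
theorem notMem_of_mem_uEdges {e : Sym2 V} (he : e ∈ uEdges ω D) : e ∉ D := by
  obtain ⟨a, b, rfl, h⟩ := he
  exact h.2.1

/-- The `a`-side of a `U`-pair is infinite. [cite: Raoufi2020, §3, p. 7 (the event A_xy)] -/
theorem IsUPair.side_infinite (h : IsUPair ω D a b) : (side ω a b).Infinite := h.2.2.1

/-- For a special pair, no other `U`-edge has *any* endpoint on the `a`-side. [folklore] -/
theorem IsSpecial.notMem_side (h : IsSpecial ω D a b) {a' b' : V} (h' : IsUPair ω D a' b')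
    (hne : s(a', b') ≠ s(a, b)) : a' ∉ side ω a b ∧ b' ∉ side ω a b :=
  ⟨h.2 a' b' h' hne, h.2 b' a' h'.symm (by rwa [Sym2.eq_swap])⟩

end UEdges

/-! ### Three infinite clusters of `ω ∖ E` give three branches -/

section ThreeClusters

variable [DecidableEq V] {G : SimpleGraph V} [G.LocallyFinite]

/-- **Three clusters of a finitely punctured configuration give three branches.** If, after closing the
finitely many bonds of `E`, three vertices of a finite set `K ⊇ ⋃ E` lie in distinct infinite open
clusters, then `ω ∈ threeBranches`: each infinite cluster of `ω ∖ E` leaves `K` into an infinite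
cluster of `ω - K` (`exists_branch_of_percolatesAt`), paths avoiding `K` avoid `E`, so the three exits
are disconnected in `ω - K`. [folklore] -/
theorem mem_threeBranches_of_three_clusters {ω : BondConfig V} (hωG : ω ⊆ G.edgeSet)
    (E : Finset (Sym2 V)) (K : Finset V) (hEK : ∀ e ∈ E, ∀ x ∈ e, x ∈ K) {b : Fin 3 → V}
    (hbK : ∀ i, b i ∈ K) (hperc : ∀ i, (ω \ ↑E) ∈ percolatesAt (b i))
    (hdis : ∀ i j, (openGraph (ω \ ↑E)).Reachable (b i) (b j) → i = j) :
    ω ∈ threeBranches V := by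
  set ω₀ : BondConfig V := ω \ ↑E with hω₀
  have hω₀ω : ω₀ ⊆ ω := Set.sdiff_subset
  have hω₀G : ω₀ ⊆ G.edgeSet := hω₀ω.trans hωG
  choose w hwK _hwadj hbw hwperc using
    fun i => exists_branch_of_percolatesAt K hω₀G (hbK i) (hperc i)
  -- paths avoiding `K` avoid the bonds of `E`
  have hsub : ω ∩ (withinGraph ⊤ (↑K : Set V)ᶜ).edgeSet ⊆ ω₀ := by
    rintro e ⟨heω, heK⟩
    refine ⟨heω, fun heE => ?_⟩
    induction e using Sym2.ind with
    | h x y =>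
      rw [SimpleGraph.mem_edgeSet, withinGraph_adj] at heK
      exact heK.2.1 (hEK _ heE x (Sym2.mem_mk_left x y))
  refine ⟨K, w, fun i j hij => ?_, fun i => isUpperSet_percolatesVia _ _ hω₀ω (hwperc i)⟩
  change w j ∈ openCluster (ω ∩ (withinGraph ⊤ (↑K : Set V)ᶜ).edgeSet) (w i) at hij
  have hij₀ : (openGraph ω₀).Reachable (w i) (w j) := openCluster_mono hsub (w i) hij
  exact hdis i j (((hbw i).trans hij₀).trans (hbw j).symm)

end ThreeClusters

/-! ### Lemma 3 (i), (ii): deterministic cores -/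

section LemmaThree

variable {ω : BondConfig V} {D : Set (Sym2 V)}

/-- **Two 1-disjoint open walks avoid the `U`-edges** (the deterministic content of "if `f(x,y,n) ≥ 2`
then `x` is connected to `y` in `n'`", Raoufi 2020, proof of Lemma 3 (i), p. 10): if every bond used by
both walks is doubled (which is what two edge-disjoint paths of the multigraph of `n` provide), then `x`
and `y` are joined in `ω` with all `U`-edges closed. Indeed a `U`-edge `e` on the first walk (made a path)
is not doubled, so the second walk avoids it, and path-before-`e` + second walk + path-after-`e` would
join the endpoints of the bridge `e`. [cite: Raoufi2020, Lemma 3 (i), proof (p. 10)] -/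
theorem reachable_sdiff_uEdges_of_oneDisjoint {x y : V} (p₁ p₂ : (openGraph ω).Walk x y)
    (h : ∀ e, e ∈ p₁.edges → e ∈ p₂.edges → e ∈ D) :
    (openGraph (ω \ uEdges ω D)).Reachable x y := by
  classical
  set q := p₁.bypass with hq
  have hqpath : q.IsPath := p₁.bypass_isPath
  refine reachable_sdiff_of_walk_avoiding (uEdges ω D) q fun e heq heU => ?_
  have he₁ : e ∈ p₁.edges := p₁.edges_bypass_subset_edges heq
  obtain ⟨a, b, rfl, hab⟩ := heU
  have he₂ : s(a, b) ∉ p₂.edges := fun he₂ => hab.2.1 (h _ he₁ he₂)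
  -- the second walk joins `x` to `y` without the bridge
  have hxy : (openGraph (ω \ {s(a, b)})).Reachable x y :=
    reachable_sdiff_of_walk_avoiding {s(a, b)} p₂ fun e he hes => by
      rw [Set.mem_singleton_iff] at hes
      exact he₂ (hes ▸ he)
  rcases reachable_sdiff_of_isTrail_of_mem_edges hqpath.isTrail heq with ⟨hxa, hby⟩ | ⟨hxb, hay⟩
  · exact hab.1.2.2 ((hxa.symm.trans hxy).trans hby.symm)
  · exact hab.1.2.2 ((hay.trans hxy.symm).trans hxb)

variable [DecidableEq V] {G : SimpleGraph V} [G.LocallyFinite]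

/-- **Three pairwise 1-disjoint open walks leaving the `U`-closed cluster force three branches** (the
deterministic content of Raoufi 2020, proof of Lemma 3 (ii), p. 11: "each of them has an element of
`U(n)` and from this and the definition of `U(n)` we infer that the number of ends of the infinite
cluster is at least 3"). Hypotheses: `ω ⊆ E(G)` with `G` locally finite; the open cluster of `x` in `ω`
with the `U`-edges closed lies inside `S`; three open walks from `x` to vertices outside `S` such that a
bond used by two of them is doubled. Proof: each walk uses a `U`-edge; let `eᵢ = s(aᵢ,bᵢ)` be the first
one (so `x ↔ aᵢ` avoiding `U`); `eᵢ` is not on the other walks (it is not doubled); after closing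
`e₁,e₂,e₃` the vertices `b₁,b₂,b₃` lie in three distinct infinite clusters (a finite one, or a connection
between two of them, would reconnect the endpoints of a bridge `eᵢ` avoiding it), and three such clusters
give three branches. [cite: Raoufi2020, Lemma 3 (ii), proof (p. 11)] -/
theorem mem_threeBranches_of_three_oneDisjoint_walks (hωG : ω ⊆ G.edgeSet) {x : V} {S : Set V}
    (hS : openCluster (ω \ uEdges ω D) x ⊆ S) {t : Fin 3 → V} (ht : ∀ i, t i ∉ S)
    (p : ∀ i, (openGraph ω).Walk x (t i))
    (h : ∀ i j, i ≠ j → ∀ e, e ∈ (p i).edges → e ∈ (p j).edges → e ∈ D) :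
    ω ∈ threeBranches V := by
  -- each walk uses a `U`-edge; take the first one
  have hfirst : ∀ i, ∃ a b, s(a, b) ∈ uEdges ω D ∧ s(a, b) ∈ (p i).edges ∧ s(a, b) ∈ ω ∧ a ≠ b ∧
      (openGraph (ω \ uEdges ω D)).Reachable x a := fun i => by
    refine exists_first_mem_edges (uEdges ω D) (p i) ?_
    by_contra hno
    push Not at hno
    exact ht i (hS (reachable_sdiff_of_walk_avoiding (uEdges ω D) (p i) hno))
  choose a b hU hmem hω hne hxa using hfirst
  have hpair : ∀ i, IsUPair ω D (a i) (b i) := fun i => isUPair_of_mem_uEdges (hU i)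
  -- the first `U`-edge of one walk is not on the other walks
  have hexcl : ∀ i j, i ≠ j → s(a i, b i) ∉ (p j).edges := fun i j hij hj =>
    notMem_of_mem_uEdges (hU i) (h i j hij _ (hmem i) hj)
  have hinj : ∀ i j, s(a i, b i) = s(a j, b j) → i = j := fun i j hij => by
    by_contra hne'
    exact hexcl i j hne' (hij ▸ hmem j)
  set E : Finset (Sym2 V) := Finset.univ.image fun i => s(a i, b i) with hE
  have hmemE : ∀ i, s(a i, b i) ∈ E := fun i => Finset.mem_image_of_mem _ (Finset.mem_univ i)
  have hEsub : (↑E : Set (Sym2 V)) ⊆ uEdges ω D := by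
    intro e he
    rw [hE, Finset.coe_image] at he
    obtain ⟨i, -, rfl⟩ := he
    exact hU i
  -- `ω ∖ U ⊆ ω ∖ E ⊆ ω ∖ {eᵢ}`
  have hUE : ω \ uEdges ω D ⊆ ω \ ↑E := Set.sdiff_subset_sdiff_right hEsub
  have hEi : ∀ i, ω \ ↑E ⊆ ω \ {s(a i, b i)} := fun i =>
    Set.sdiff_subset_sdiff_right (Set.singleton_subset_iff.2 (hmemE i))
  have hxa' : ∀ i, (openGraph (ω \ ↑E)).Reachable x (a i) := fun i => reachable_of_config_subset hUE (hxa i)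
  -- distinct clusters of the `bᵢ` in `ω ∖ E`
  have hdis : ∀ i j, (openGraph (ω \ ↑E)).Reachable (b i) (b j) → i = j := by
    intro i j hij
    by_contra hne'
    -- `aᵢ ↔ x ↔ aⱼ — bⱼ ↔ bᵢ` avoiding `eᵢ`
    have h1 : (openGraph (ω \ {s(a i, b i)})).Reachable (a i) (a j) :=
      reachable_of_config_subset (hEi i) ((hxa' i).symm.trans (hxa' j))
    have h2 : (openGraph (ω \ {s(a i, b i)})).Adj (a j) (b j) := by
      rw [openGraph_adj]
      refine ⟨⟨hω j, ?_⟩, hne j⟩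
      rw [Set.mem_singleton_iff]
      exact fun heq => hne' (hinj j i heq).symm
    have h3 : (openGraph (ω \ {s(a i, b i)})).Reachable (b j) (b i) :=
      reachable_of_config_subset (hEi i) hij.symm
    exact (hpair i).1.2.2 ((h1.trans h2.reachable).trans h3)
  -- the clusters of the `bᵢ` in `ω ∖ E` are infinite
  have hperc : ∀ i, (ω \ ↑E) ∈ percolatesAt (b i) := by
    intro i hfin
    change (openCluster (ω \ ↑E) (b i)).Finite at hfin
    have hinf : (openCluster (ω \ {s(a i, b i)}) (b i)).Infinite := (hpair i).2.2.2
    obtain ⟨v, hv, hvnot⟩ := (hinf.sdiff hfin).nonempty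
    obtain ⟨q⟩ := (show (openGraph (ω \ {s(a i, b i)})).Reachable (b i) v from hv)
    have hset : (ω \ {s(a i, b i)}) \ ↑E = ω \ ↑E := by
      rw [Set.sdiff_sdiff, Set.union_eq_self_of_subset_left (Set.singleton_subset_iff.2 (by exact_mod_cast hmemE i))]
    rcases reachable_sdiff_or_exists_first (↑E) q with hreach | ⟨c, c', hcE, hcq, -, -, hbc⟩
    · rw [hset] at hreach
      exact hvnot hreach
    · rw [hset] at hbc
      rw [hE, Finset.coe_image] at hcE
      obtain ⟨j, -, hj⟩ := hcE
      -- `c` is an endpoint of `eⱼ`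
      have hj' : s(a j, b j) = s(c, c') := hj
      have hc : c = a j ∨ c = b j := by
        have : c ∈ s(a j, b j) := by rw [hj']; exact Sym2.mem_mk_left c c'
        exact Sym2.mem_iff.1 this
      rcases hc with rfl | rfl
      · -- `aᵢ ↔ x ↔ aⱼ = c ↔ bᵢ` avoiding `eᵢ`
        exact (hpair i).1.2.2 (reachable_of_config_subset (hEi i) (((hxa' i).symm.trans (hxa' j)).trans hbc.symm))
      · by_cases hji : j = i
        · subst hji
          -- the walk `q` avoids `eⱼ = eᵢ` but uses `s(c,c') = eᵢ`
          have := mem_of_mem_edges q hcq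
          rw [← hj'] at this
          exact this.2 rfl
        · exact hji (hdis j i hbc.symm)
  -- the finite set of all endpoints
  set K : Finset V := Finset.univ.biUnion fun i => ({a i, b i} : Finset V) with hK
  have haK : ∀ i, a i ∈ K := fun i => Finset.mem_biUnion.2 ⟨i, Finset.mem_univ i, by simp⟩
  have hbK : ∀ i, b i ∈ K := fun i => Finset.mem_biUnion.2 ⟨i, Finset.mem_univ i, by simp⟩
  refine mem_threeBranches_of_three_clusters hωG E K (fun e he v hv => ?_) hbK hperc hdis
  rw [hE, Finset.mem_image] at he
  obtain ⟨i, -, rfl⟩ := he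
  rcases Sym2.mem_iff.1 hv with rfl | rfl
  · exact haK i
  · exact hbK i

end LemmaThree

/-! ### Two `U`-edges: the three pieces -/

section TwoBridgesSec

/-- **Two bridges in position**: `e = s(a,b)` and `e' = s(a',b')` are distinct bridges, `e'` lies on
the `a`-side of `e` and `e` lies on the `b'`-side of `e'` (every pair of distinct bridges of one cluster
can be labelled this way, `exists_twoBridges`). Then `ω ∖ {e,e'}` falls into the `b`-side of `e`, the
`a'`-side of `e'`, and the middle piece `C_a(ω ∖ {e,e'}) ∋ a, b'` (Raoufi 2020, proof of Lemma 4,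
p. 12, the configuration `n'`). [cite: Raoufi2020, Lemma 4, proof (p. 12)] -/
structure TwoBridges (ω : BondConfig V) (a b a' b' : V) : Prop where
  /-- `s(a,b)` is a bridge -/
  bridge₁ : IsBridge ω a b
  /-- `s(a',b')` is a bridge -/
  bridge₂ : IsBridge ω a' b'
  /-- the two bonds are distinct -/
  ne : s(a, b) ≠ s(a', b')
  /-- `e'` lies on the `a`-side of `e` -/
  mem_side₁ : a' ∈ side ω a b
  /-- `e` lies on the `b'`-side of `e'` -/
  mem_side₂ : a ∈ side ω b' a'

namespace TwoBridges

variable {ω : BondConfig V} {a b a' b' : V}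

/-- `b'` lies on the `a`-side of `e` too. [folklore] -/
theorem mem_side₁' (h : TwoBridges ω a b a' b') : b' ∈ side ω a b :=
  (mem_side_iff_of_ne h.bridge₂.1 h.bridge₂.2.1 h.ne.symm).1 h.mem_side₁

/-- `b` lies on the `b'`-side of `e'` too. [folklore] -/
theorem mem_side₂' (h : TwoBridges ω a b a' b') : b ∈ side ω b' a' :=
  (mem_side_iff_of_ne h.bridge₁.1 h.bridge₁.2.1 fun heq => h.ne (heq.trans Sym2.eq_swap)).1 h.mem_side₂

/-- `ω ∖ {e,e'}` as an iterated difference. [folklore] -/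
theorem sdiff_sdiff_eq₁ (ω : BondConfig V) (a b a' b' : V) :
    (ω \ {s(a, b)}) \ {s(a', b')} = ω \ ({s(a, b), s(a', b')} : Set (Sym2 V)) := by
  rw [Set.sdiff_sdiff, ← Set.insert_eq]

/-- `ω ∖ {e,e'}` as the other iterated difference. [folklore] -/
theorem sdiff_sdiff_eq₂ (ω : BondConfig V) (a b a' b' : V) :
    (ω \ {s(a', b')}) \ {s(a, b)} = ω \ ({s(a, b), s(a', b')} : Set (Sym2 V)) := by
  rw [Set.sdiff_sdiff, Set.union_comm, ← Set.insert_eq]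

/-- `ω ∖ {e,e'} ⊆ ω ∖ {e}`. [folklore] -/
theorem sdiff_pair_subset₁ (ω : BondConfig V) (a b a' b' : V) :
    ω \ ({s(a, b), s(a', b')} : Set (Sym2 V)) ⊆ ω \ {s(a, b)} :=
  Set.sdiff_subset_sdiff_right (Set.singleton_subset_iff.2 (Set.mem_insert _ _))

/-- `ω ∖ {e,e'} ⊆ ω ∖ {e'}`. [folklore] -/
theorem sdiff_pair_subset₂ (ω : BondConfig V) (a b a' b' : V) :
    ω \ ({s(a, b), s(a', b')} : Set (Sym2 V)) ⊆ ω \ {s(a', b')} :=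
  Set.sdiff_subset_sdiff_right (Set.singleton_subset_iff.2 (Set.mem_insert_of_mem _ rfl))

/-- **The `b`-side of `e` is a cluster of `ω ∖ {e,e'}`** (it does not contain `e'`). [cite: Raoufi2020, Lemma 4, proof (p. 12)] -/
theorem openCluster_sdiff_pair_eq_side (h : TwoBridges ω a b a' b') :
    openCluster (ω \ ({s(a, b), s(a', b')} : Set (Sym2 V))) b = side ω b a := by
  refine Set.Subset.antisymm ?_ ?_
  · rw [side_swap_eq]
    exact openCluster_mono (sdiff_pair_subset₁ ω a b a' b') b
  · rw [side_swap_eq, ← sdiff_sdiff_eq₁]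
    refine openCluster_subset_openCluster_sdiff fun e he _ y hy hyb => ?_
    rw [Set.mem_singleton_iff] at he
    subst he
    have hyb' : y ∈ side ω b a := by rwa [side_swap_eq]
    rcases Sym2.mem_iff.1 hy with rfl | rfl
    · exact h.bridge₁.disjoint_sides h.mem_side₁ hyb'
    · exact h.bridge₁.disjoint_sides h.mem_side₁' hyb'

/-- **The `a'`-side of `e'` is a cluster of `ω ∖ {e,e'}`** (a walk from `a'` avoiding `e'` cannot use
`e`, whose endpoints are on the other side of `e'`). [cite: Raoufi2020, Lemma 4, proof (p. 12)] -/
theorem openCluster_sdiff_pair_eq_side' (h : TwoBridges ω a b a' b') :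
    openCluster (ω \ ({s(a, b), s(a', b')} : Set (Sym2 V))) a' = side ω a' b' := by
  refine Set.Subset.antisymm (openCluster_mono (sdiff_pair_subset₂ ω a b a' b') a') fun v hv => ?_
  obtain ⟨q⟩ := (show (openGraph (ω \ {s(a', b')})).Reachable a' v from hv)
  rcases reachable_sdiff_or_exists_first {s(a, b)} q with hreach | ⟨x, y, hxy, -, -, -, hax⟩
  · rwa [sdiff_sdiff_eq₂] at hreach
  · exfalso
    rw [sdiff_sdiff_eq₂] at hax
    rw [Set.mem_singleton_iff] at hxy
    -- `x ∈ {a, b}` lies on the `a'`-side and on the `b'`-side of `e'`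
    have hx : x ∈ side ω a' b' := reachable_of_config_subset (sdiff_pair_subset₂ ω a b a' b') hax
    rcases Sym2.eq_iff.1 hxy with ⟨rfl, rfl⟩ | ⟨rfl, rfl⟩
    · exact h.bridge₂.disjoint_sides hx h.mem_side₂
    · exact h.bridge₂.disjoint_sides hx h.mem_side₂'

/-- **The middle piece contains `b'`**: `a ↔ b'` in `ω ∖ {e,e'}`. [cite: Raoufi2020, Lemma 4, proof (p. 12)] -/
theorem reachable_sdiff_pair (h : TwoBridges ω a b a' b') :
    (openGraph (ω \ ({s(a, b), s(a', b')} : Set (Sym2 V)))).Reachable a b' := by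
  have hb'a : (openGraph (ω \ {s(a', b')})).Reachable b' a := (mem_side_swap_iff).1 h.mem_side₂
  obtain ⟨q⟩ := hb'a
  rcases reachable_sdiff_or_exists_first {s(a, b)} q with hreach | ⟨x, y, hxy, -, -, -, hbx⟩
  · rw [sdiff_sdiff_eq₂] at hreach
    exact hreach.symm
  · rw [sdiff_sdiff_eq₂] at hbx
    rw [Set.mem_singleton_iff] at hxy
    rcases Sym2.eq_iff.1 hxy with ⟨rfl, rfl⟩ | ⟨rfl, rfl⟩
    · exact hbx.symm
    · -- `b' ↔ b` in `ω ∖ {e,e'}` would put `b'` on the `b`-side of `e`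
      exfalso
      have hb'b : b' ∈ openCluster (ω \ ({s(y, x), s(a', b')} : Set (Sym2 V))) x := hbx.symm
      rw [h.openCluster_sdiff_pair_eq_side] at hb'b
      exact h.bridge₁.disjoint_sides h.mem_side₁' hb'b

/-- `b` is not in the middle piece. [folklore] -/
theorem notMem_middle (h : TwoBridges ω a b a' b') :
    b ∉ openCluster (ω \ ({s(a, b), s(a', b')} : Set (Sym2 V))) a := fun hb =>
  h.bridge₁.2.2 (reachable_of_config_subset (sdiff_pair_subset₁ ω a b a' b') hb)

/-- `a'` is not in the middle piece. [folklore] -/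
theorem notMem_middle' (h : TwoBridges ω a b a' b') :
    a' ∉ openCluster (ω \ ({s(a, b), s(a', b')} : Set (Sym2 V))) a := fun ha' =>
  h.bridge₂.2.2 (reachable_of_config_subset (sdiff_pair_subset₂ ω a b a' b')
    ((show (openGraph _).Reachable a a' from ha').symm.trans h.reachable_sdiff_pair))

/-- `b` is not on the `a'`-piece either. [folklore] -/
theorem notMem_side' (h : TwoBridges ω a b a' b') :
    b ∉ openCluster (ω \ ({s(a, b), s(a', b')} : Set (Sym2 V))) a' := fun hb => by
  rw [h.openCluster_sdiff_pair_eq_side'] at hb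
  exact h.bridge₂.disjoint_sides hb h.mem_side₂'

/-- **The `a`-side of `e` is the middle piece together with the `a'`-side of `e'`.** [cite: Raoufi2020, Lemma 4, proof (p. 12)] -/
theorem mem_or_mem (h : TwoBridges ω a b a' b') {v : V} (hv : v ∈ side ω a b) :
    v ∈ openCluster (ω \ ({s(a, b), s(a', b')} : Set (Sym2 V))) a ∨
      v ∈ openCluster (ω \ ({s(a, b), s(a', b')} : Set (Sym2 V))) a' := by
  obtain ⟨q⟩ := (show (openGraph (ω \ {s(a, b)})).Reachable a v from hv).symm
  rcases reachable_sdiff_or_exists_first {s(a', b')} q with hreach | ⟨x, y, hxy, -, -, -, hvx⟩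
  · rw [sdiff_sdiff_eq₁] at hreach
    exact Or.inl hreach.symm
  · rw [sdiff_sdiff_eq₁] at hvx
    rw [Set.mem_singleton_iff] at hxy
    rcases Sym2.eq_iff.1 hxy with ⟨rfl, rfl⟩ | ⟨rfl, rfl⟩
    · exact Or.inr hvx.symm
    · exact Or.inl (h.reachable_sdiff_pair.trans hvx.symm)

/-- **An infinite middle piece gives three branches**: if `b` and `a'` are joined to infinity off their
bridges (as for `U`-pairs) and the middle piece is infinite, then `b`, `a`, `a'` lie in three distinct
infinite clusters of `ω ∖ {e,e'}`. [cite: Raoufi2020, Lemma 3, Claim 1 (proof, pp. 10–11)] -/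
theorem mem_threeBranches_of_infinite [DecidableEq V] {G : SimpleGraph V} [G.LocallyFinite]
    (h : TwoBridges ω a b a' b') (hωG : ω ⊆ G.edgeSet) (hb : (ω \ {s(a, b)}) ∈ percolatesAt b)
    (ha' : (ω \ {s(a', b')}) ∈ percolatesAt a')
    (hX : (openCluster (ω \ ({s(a, b), s(a', b')} : Set (Sym2 V))) a).Infinite) :
    ω ∈ threeBranches V := by
  have hE : (↑({s(a, b), s(a', b')} : Finset (Sym2 V)) : Set (Sym2 V)) = {s(a, b), s(a', b')} := by
    push_cast; rfl
  refine mem_threeBranches_of_three_clusters hωG {s(a, b), s(a', b')} {a, b, a', b'}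
    (fun e he v hv => ?_) (b := ![b, a, a']) (fun i => ?_) (fun i => ?_) (fun i j hij => ?_)
  · simp only [Finset.mem_insert, Finset.mem_singleton] at he
    rcases he with rfl | rfl <;> rcases Sym2.mem_iff.1 hv with rfl | rfl <;> simp
  · fin_cases i <;> simp
  · rw [hE]
    fin_cases i
    · change (openCluster _ b).Infinite
      rw [h.openCluster_sdiff_pair_eq_side, side_swap_eq]
      exact hb
    · exact hX
    · change (openCluster _ a').Infinite
      rw [h.openCluster_sdiff_pair_eq_side']
      exact ha'
  · rw [hE] at hij
    fin_cases i <;> fin_cases j <;> simp at hij ⊢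
    · exact h.notMem_middle hij.symm
    · exact h.notMem_side' hij.symm
    · exact h.notMem_middle hij
    · exact h.notMem_middle' hij
    · exact h.notMem_side' hij
    · exact h.notMem_middle' hij.symm

/-- **Summary for Lemma 4** (Raoufi 2020, p. 12): for two bridges in position with infinite outer sides,
either there are three infinite branches, or the middle piece `X = C_a(ω ∖ {e,e'})` is finite, joins `a`
to `b'`, and misses the other two endpoints `b`, `a'` — with `x = a`, `y = b'`, `x' = b`, `y' = a'` this
is "`n' ∈ B_m(x,x',y,y')` for some `m`". [cite: Raoufi2020, Lemma 4, proof (p. 12)] -/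
theorem threeBranches_or_finite_middle [DecidableEq V] {G : SimpleGraph V} [G.LocallyFinite]
    (h : TwoBridges ω a b a' b') (hωG : ω ⊆ G.edgeSet) (hb : (ω \ {s(a, b)}) ∈ percolatesAt b)
    (ha' : (ω \ {s(a', b')}) ∈ percolatesAt a') :
    ω ∈ threeBranches V ∨
      ((openCluster (ω \ ({s(a, b), s(a', b')} : Set (Sym2 V))) a).Finite ∧
        (openGraph (ω \ ({s(a, b), s(a', b')} : Set (Sym2 V)))).Reachable a b' ∧
        b ∉ openCluster (ω \ ({s(a, b), s(a', b')} : Set (Sym2 V))) a ∧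
        a' ∉ openCluster (ω \ ({s(a, b), s(a', b')} : Set (Sym2 V))) a) := by
  by_cases hX : (openCluster (ω \ ({s(a, b), s(a', b')} : Set (Sym2 V))) a).Finite
  · exact Or.inr ⟨hX, h.reachable_sdiff_pair, h.notMem_middle, h.notMem_middle'⟩
  · exact Or.inl (h.mem_threeBranches_of_infinite hωG hb ha' hX)

end TwoBridges

/-- **Any two distinct bridges of one cluster can be put in position** (relabelling the endpoints). [folklore] -/
theorem exists_twoBridges {ω : BondConfig V} {a b c d : V} (h₁ : IsBridge ω a b) (h₂ : IsBridge ω c d)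
    (hne : s(a, b) ≠ s(c, d)) (hreach : (openGraph ω).Reachable a c) :
    ∃ a₁ b₁ a₂ b₂, s(a₁, b₁) = s(a, b) ∧ s(a₂, b₂) = s(c, d) ∧ TwoBridges ω a₁ b₁ a₂ b₂ := by
  -- first orient `e` so that `c` is on the `a₁`-side
  have key : ∀ a₁ b₁, s(a₁, b₁) = s(a, b) → IsBridge ω a₁ b₁ → c ∈ side ω a₁ b₁ →
      ∃ a₁ b₁ a₂ b₂, s(a₁, b₁) = s(a, b) ∧ s(a₂, b₂) = s(c, d) ∧ TwoBridges ω a₁ b₁ a₂ b₂ := by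
    intro a₁ b₁ he hb hc
    have hne' : s(a₁, b₁) ≠ s(c, d) := he ▸ hne
    have hca : (openGraph ω).Reachable c a₁ :=
      (reachable_of_config_subset Set.sdiff_subset (show (openGraph _).Reachable a₁ c from hc)).symm
    rcases h₂.mem_side_or hca with hor | hor
    · -- `a₁` on the `c`-side of `s(c,d)`: use `(d, c)`
      have hd : d ∈ side ω a₁ b₁ := (mem_side_iff_of_ne h₂.1 h₂.2.1 hne'.symm).1 hc
      exact ⟨a₁, b₁, d, c, he, Sym2.eq_swap, hb, h₂.symm, fun heq => hne' (heq.trans Sym2.eq_swap), hd, hor⟩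
    · exact ⟨a₁, b₁, c, d, he, rfl, hb, h₂, hne', hc, hor⟩
  rcases h₁.mem_side_or hreach with hc | hc
  · exact key a b rfl h₁ hc
  · exact key b a Sym2.eq_swap h₁.symm hc

end TwoBridgesSec

/-! ### Claim 1: special `U`-edges exist, and three of them give three branches -/

section Special

variable [DecidableEq V] {G : SimpleGraph V} [G.LocallyFinite] {ω : BondConfig V} {D : Set (Sym2 V)}

/-- **Existence of a special `U`-edge** (the deterministic part of Raoufi 2020, Lemma 3, Claim 1,
pp. 10–11, restructured): if `ω ⊆ E(G)` has no three infinite branches, `(a₀,b₀)` is a `U`-pair, and the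
configuration `ω ∖ U(ω)` with all `U`-edges closed has an infinite cluster `R ∋ r` in the cluster of
`a₀`, then some `U`-pair is special. Proof: `R` lies on one side of every `U`-edge; starting from
`(a₀,b₀)` oriented with `R` on the `a`-side, argue by strong induction on the length of an open walk from
`r` to `a` avoiding the bridge: if the pair is not special, some `U`-edge `e'` has an endpoint on the
`a`-side; put the two bridges in position; `R` lies in the middle piece (then it is infinite: three
branches, excluded) or on the far side of `e'`, in which case the walk, cut at its first visit to `e'`,
is a strictly shorter walk to the far endpoint of `e'` avoiding `e'`. [cite: Raoufi2020, Lemma 3, Claim 1 (pp. 10–11)] -/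
theorem exists_isSpecial (hωG : ω ⊆ G.edgeSet) (h3 : ω ∉ threeBranches V) {a₀ b₀ r : V}
    (h₀ : IsUPair ω D a₀ b₀) (hr : (openGraph ω).Reachable a₀ r)
    (hR : (openCluster (ω \ uEdges ω D) r).Infinite) : ∃ a b, IsSpecial ω D a b := by
  -- `ω ∖ U ⊆ ω ∖ {e}` for every `U`-edge `e`
  have hUsub : ∀ {a b : V}, IsUPair ω D a b → ω \ uEdges ω D ⊆ ω \ {s(a, b)} := fun hab =>
    Set.sdiff_subset_sdiff_right (Set.singleton_subset_iff.2 hab.mem_uEdges)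
  suffices key : ∀ n (a b : V), IsUPair ω D a b → r ∈ side ω a b →
      (∃ p : (openGraph (ω \ {s(a, b)})).Walk r a, p.length ≤ n) → ∃ a b, IsSpecial ω D a b by
    rcases h₀.1.mem_side_or hr with hra | hrb
    · obtain ⟨p⟩ := (show (openGraph (ω \ {s(a₀, b₀)})).Reachable a₀ r from hra).symm
      exact key p.length a₀ b₀ h₀ hra ⟨p, le_rfl⟩
    · obtain ⟨p⟩ := (show (openGraph (ω \ {s(b₀, a₀)})).Reachable b₀ r from hrb).symm
      exact key p.length b₀ a₀ h₀.symm hrb ⟨p, le_rfl⟩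
  intro n
  induction n using Nat.strong_induction_on with
  | _ n IH =>
  rintro a b hab hra ⟨p, hp⟩
  by_cases hsp : IsSpecial ω D a b
  · exact ⟨a, b, hsp⟩
  -- a non-special `U`-pair has another `U`-edge with an endpoint on its `a`-side
  obtain ⟨a₁, b₁, h₁, hne₁, hmem₁⟩ : ∃ a' b', IsUPair ω D a' b' ∧ s(a', b') ≠ s(a, b) ∧ a' ∈ side ω a b := by
    by_contra hno
    push Not at hno
    exact hsp ⟨hab, fun a' b' h' hne' hmem' => hno a' b' h' hne' hmem'⟩
  -- the generic step, for `e₁` oriented so that `e` is on the `b'`-side of `e₁`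
  have step : ∀ a' b', IsUPair ω D a' b' → s(a', b') ≠ s(a, b) → a' ∈ side ω a b → a ∈ side ω b' a' →
      ∃ a b, IsSpecial ω D a b := by
    intro a' b' h' hne' hmem' hor
    have tb : TwoBridges ω a b a' b' := ⟨hab.1, h'.1, hne'.symm, hmem', hor⟩
    have hsubT : ω \ uEdges ω D ⊆ ω \ ({s(a, b), s(a', b')} : Set (Sym2 V)) :=
      Set.sdiff_subset_sdiff_right (Set.insert_subset_iff.2 ⟨hab.mem_uEdges, Set.singleton_subset_iff.2 h'.mem_uEdges⟩)
    rcases tb.mem_or_mem hra with hrX | hrA'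
    · -- `R` inside the middle piece, which is then infinite: three branches
      refine absurd (tb.mem_threeBranches_of_infinite hωG hab.2.2.2 h'.2.2.1 ?_) h3
      refine Set.Infinite.mono (fun v hv => ?_) hR
      exact (show (openGraph _).Reachable a r from hrX).trans (reachable_of_config_subset hsubT hv)
    · -- `r` on the `a'`-side of `e'`: recurse with a strictly shorter walk
      have hrA'r : (openGraph (ω \ ({s(a, b), s(a', b')} : Set (Sym2 V)))).Reachable a' r := hrA'
      have hra' : r ∈ side ω a' b' :=
        openCluster_mono (TwoBridges.sdiff_pair_subset₂ ω a b a' b') a' hrA'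
      -- `a'` lies on the walk `p`
      have ha'p : a' ∈ p.support := by
        by_contra hnot
        have havoid : ∀ e ∈ p.edges, e ∉ ({s(a', b')} : Set (Sym2 V)) := fun e he hes => by
          rw [Set.mem_singleton_iff] at hes
          subst hes
          exact hnot (p.fst_mem_support_of_mem_edges he)
        have hreach := reachable_sdiff_of_walk_avoiding {s(a', b')} p havoid
        rw [TwoBridges.sdiff_sdiff_eq₁] at hreach
        exact tb.notMem_middle' (hrA'r.trans hreach).symm
      have hne_aa' : a' ≠ a := by
        rintro rfl
        exact tb.notMem_middle' (mem_openCluster_self _ _)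
      set p₁ := p.takeUntil a' ha'p with hp₁
      have hp₁len : p₁.length < p.length := Walk.length_takeUntil_lt_length ha'p hne_aa'
      obtain ⟨w, hwT, q, hqlen, hqedges, honly⟩ :=
        exists_walk_meets_only_at_end p₁ ({a', b'} : Set V) (Set.mem_insert _ _)
      -- `q` avoids `e'`
      have hqavoid : ∀ e ∈ q.edges, e ≠ s(a', b') := by
        intro e he hee
        subst hee
        have h1 := honly a' (q.fst_mem_support_of_mem_edges he) (Set.mem_insert _ _)
        have h2 := honly b' (q.snd_mem_support_of_mem_edges he) (Set.mem_insert_of_mem _ rfl)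
        exact h'.1.2.1 (h1.trans h2.symm)
      have hqω : ∀ e ∈ q.edges, e ∈ ω \ ({s(a, b), s(a', b')} : Set (Sym2 V)) := fun e he => by
        rw [← TwoBridges.sdiff_sdiff_eq₁]
        exact ⟨mem_of_mem_edges q he, by rw [Set.mem_singleton_iff]; exact hqavoid e he⟩
      -- the endpoint `w` is `a'`
      have hw : w = a' := by
        rcases hwT with hw | hw
        · exact hw
        · rw [Set.mem_singleton_iff] at hw
          subst hw
          exfalso
          have hrb' := reachable_of_walk_edges_subset q hqω
          exact h'.1.2.2 (reachable_of_config_subset (TwoBridges.sdiff_pair_subset₂ ω a b a' _) (hrA'r.trans hrb'))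
      subst hw
      have hq' : ∀ e ∈ q.edges, e ∈ ω \ {s(w, b')} := fun e he =>
        TwoBridges.sdiff_pair_subset₂ ω a b w b' (hqω e he)
      have hlt : (transferWalk (ω \ {s(w, b')}) q hq').length < n := by
        rw [length_transferWalk]; omega
      exact IH _ hlt w b' h' hra' ⟨transferWalk (ω \ {s(w, b')}) q hq', le_rfl⟩
  -- dispatch on the orientation of `e₁`
  have haa₁ : (openGraph ω).Reachable a₁ a :=
    (reachable_of_config_subset Set.sdiff_subset (show (openGraph _).Reachable a a₁ from hmem₁)).symm
  rcases h₁.1.mem_side_or haa₁ with hor | hor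
  · have hmem₁' : b₁ ∈ side ω a b := (mem_side_iff_of_ne h₁.1.1 h₁.1.2.1 hne₁).1 hmem₁
    exact step b₁ a₁ h₁.symm (fun heq => hne₁ (Sym2.eq_swap.trans heq)) hmem₁' hor
  · exact step a₁ b₁ h₁ hne₁ hmem₁ hor

/-- **Three special `U`-edges give three branches** (Raoufi 2020, proof of Claim 1, last paragraph,
p. 10: "in the induced subgraph of `G ∖ {u'₀,u'₁,u''₀,u''₁}` in `M`, the paths `p`, `p'`, and `p''` belong
to three different connected components. This implies that the number of ends of the infinite cluster of
`n` is at least 3"): the `aᵢ`-sides of three special pairs with distinct bonds are three distinct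
infinite clusters of `ω` with the three bonds closed. [cite: Raoufi2020, Lemma 3, Claim 1 (proof, p. 10)] -/
theorem mem_threeBranches_of_three_isSpecial (hωG : ω ⊆ G.edgeSet) {a b : Fin 3 → V}
    (hsp : ∀ i, IsSpecial ω D (a i) (b i)) (hinj : ∀ i j, s(a i, b i) = s(a j, b j) → i = j) :
    ω ∈ threeBranches V := by
  set E : Finset (Sym2 V) := Finset.univ.image fun i => s(a i, b i) with hE
  have hmemE : ∀ i, s(a i, b i) ∈ E := fun i => Finset.mem_image_of_mem _ (Finset.mem_univ i)
  have hEi : ∀ i, ω \ ↑E ⊆ ω \ {s(a i, b i)} := fun i =>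
    Set.sdiff_subset_sdiff_right (Set.singleton_subset_iff.2 (hmemE i))
  set K : Finset V := Finset.univ.biUnion fun i => ({a i, b i} : Finset V) with hK
  have haK : ∀ i, a i ∈ K := fun i => Finset.mem_biUnion.2 ⟨i, Finset.mem_univ i, by simp⟩
  have hbK : ∀ i, b i ∈ K := fun i => Finset.mem_biUnion.2 ⟨i, Finset.mem_univ i, by simp⟩
  refine mem_threeBranches_of_three_clusters hωG E K (fun e he v hv => ?_) haK (fun i => ?_)
    (fun i j hij => ?_)
  · rw [hE, Finset.mem_image] at he
    obtain ⟨i, -, rfl⟩ := he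
    rcases Sym2.mem_iff.1 hv with rfl | rfl
    · exact haK i
    · exact hbK i
  · -- the `aᵢ`-side survives closing the other two bonds
    change (openCluster (ω \ ↑E) (a i)).Infinite
    have hset : (ω \ {s(a i, b i)}) \ ↑E = ω \ ↑E := by
      rw [Set.sdiff_sdiff, Set.union_eq_self_of_subset_left (Set.singleton_subset_iff.2 (by exact_mod_cast hmemE i))]
    have hsub : side ω (a i) (b i) ⊆ openCluster (ω \ ↑E) (a i) := by
      rw [← hset]
      refine openCluster_subset_openCluster_sdiff fun e he heω y hy hyside => ?_
      rw [hE, Finset.coe_image] at he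
      obtain ⟨j, -, rfl⟩ := he
      by_cases hji : j = i
      · subst hji
        exact heω.2 rfl
      · have hne : s(a j, b j) ≠ s(a i, b i) := fun h => hji (hinj j i h)
        obtain ⟨h1, h2⟩ := (hsp i).notMem_side (hsp j).1 hne
        rcases Sym2.mem_iff.1 hy with rfl | rfl
        · exact h1 hyside
        · exact h2 hyside
    exact (hsp i).1.side_infinite.mono hsub
  · by_contra hne
    have hne' : s(a j, b j) ≠ s(a i, b i) := fun h => hne (hinj j i h).symm
    exact ((hsp i).notMem_side (hsp j).1 hne').1 (reachable_of_config_subset (hEi i) hij)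

end Special

end Literature.Probability.Percolation
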